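import Summits.QuantumFields.BalabanUV.T4Continuum.Support.NE7CovariantWeitzenbockTwoForm
import Summits.QuantumFields.BalabanUV.T4Continuum.Support.NE7LatticeBianchi

/-!
# NE7FluxGradientFromTension — STEP (E1) OF THE ENERGY ROAD IN KERNEL: the flux-gradient energy of a `U(N)` periodic small-field
# configuration is bounded by its YANG–MILLS TENSION energy plus `O(a³)` per site —
# `gradFluxSq U (periodBox P) ≤ card n · Σ_x Σ_ν nhsNormSq ((δ_U F)_ν(x)) + 220·card n·d³·a³·P^d`

Cell `pub-balaban`, rung (B)+1 sub-cell t4, lineage `b2b-balaban-t4-ne7-p1`, generation 62 (CRUX PROVER NE7 #1, ruling e34b3e0c (2)); hunt (h7)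
«ENERGY ROAD to the (A)-bill at data with curvature» (`t4/b2b-balaban-t4-ne7-p1-g61/HUNT-H7-ENERGY-ROAD.md`), step (E1) = the companion of
`NE7CovariantWeitzenbockTwoForm` (general antisymmetric 2-forms) instantiated at THE FLUX.  The flux `F(x; μ<ν) = log U(∂p_{μν}(x))`
(`T4AveragingDeficitWall.flux`) is plane-indexed; its antisymmetric all-index form `B` is CHARACTERISED (`B(x;μ,ν) = F(x;μ<ν)`, `B(x;ν,μ) = −B(x;μ,ν)`;
`exists_fluxForm`, no definition introduced).  For such `B`:
* §1 `fluxForm_diag` (`B_{μμ} = 0`), `fluxForm_periodic`, `norm_fluxForm_le` (`‖B‖ ≤ 2a`), `cD_fluxForm` (`∇_κ B_{μν} = covGrad U F (x,κ;μ<ν)`),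
  `grad_energy_eq` (`Σ_μ Σ_ν nhsNormSq (∇_κ B_{μν}) = 2·Σ_π nhsNormSq (covGrad U F x κ π)`);
* §2 THE BIANCHI EXPRESSION ON ALL INDEX TRIPLES: `cyc_swap12`, `cyc_swap23` (total antisymmetry of `∇_κ B_{μν} + ∇_μ B_{νκ} + ∇_ν B_{κμ}`) and
  **`norm_cyc_le`**: it is `≤ 248·a²` for EVERY triple (sorted triples: `NE7LatticeBianchi.covariant_bianchi_le`; permutations by antisymmetry;
  degenerate triples vanish), whence `ext_energy_le`: `C₂ ≤ P^d·d³·(248a²)²`; and `normSq_fluxForm_le`: `‖B‖² ≤ P^d·d²·(2a)²`;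
* §3 **`gradFluxSq_le_tension`** (displayed above; `a ≤ 1∕50`, `P ≥ 1`): `NE7CovariantWeitzenbockTwoForm.grad_le_ext_add_div` + §1–§2 +
  `‖X‖² ≤ card n·nhsNormSq X`; and the class form **`gradFluxSq_le_tension_sfClass`**: for `U ∈ sfClass d L N ε k`, `ε·(L^k)^{−2} ≤ 1∕50`,
  `gradFluxSq U (periodBox (N·L^k)) ≤ card n·(tension energy) + 220·card n·d³·ε³ · N^d·(L^k)^d∕(L^k)⁶` — EXACTLY the currency of (H∃)ᴱ
  (`NE7EtaBackgroundEnergyClass.hminE_of_apriori`: `g·N^d·(L^k)^d∕(L^k)⁶`): the class alone gives `O(ε²)` with NO decay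
  (`NE7EtaBackgroundEnergyClassAllCutoffs.gradFluxSq_le_of_mem_sfClass`); after (E1) the whole of (H∃)ᴱ is the statement that a constrained
  minimiser's TENSION energy `Σ_x Σ_ν nhsNormSq (Σ_μ ∇_μ^† B_{μν})` is `≤ g′·N^d·(L^k)^d∕(L^k)⁶` — steps (E2) (first-order condition), (E3) (multiplier
  bound) and the interiority (8) of the hunt memo.
HONEST FRAMING (page 1): FIXED FINITE torus, rung (B)+1; [folklore] lattice gauge calculus at ONE configuration; nothing about minimisers is proved;
NE7, NE3 NOT PRINTED in [Balaban1984PropagatorsI]–[Balaban1989LargeFieldII] and NOT PROVED; continuum YM on T⁴ ⇐ BetaPertH ∧ nine spine estimates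
(0/9 proved); BetaPertH ⇐ (D1) ∧ (D4) ∧ CAP+tail; G-an2-4 gates asym, D1 and NE2/3/4; NOT infinite volume, NOT mass gap, NOT Clay.  0 def, 0 sorry.
-/

set_option autoImplicit false

open scoped BigOperators Matrix Matrix.Norms.L2Operator
open NormedSpace Finset

namespace Summit.QuantumFields.BalabanUV.T4Continuum.NE7FluxGradientFromTension

open Literature.MathematicalPhysics.QuantumFieldTheory.Balaban1983to89
open B7Prop1Explicit B7Prop2Explicit MatrixLog UnitaryModel MatrixNorms
open T4AveragingDeficitWall hiding Site Plane Plaq Bond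
open T4AveragingDeficitWallBoundary (periodBox sum_periodBox_shift IsPeriodicCfg card_periodBox)
open T4AveragingDeficitNonAbelian (Ad_mul Ad_sub)
open AveragingDeficitTransport (norm_Ad_of_unitary mem_U1_of_unitary val_inv_eq_star_of_unitary)
open AveragingDeficitNearIdentity (Ad_one norm_Ad_sub_le Ad_neg Ad_zero)
open AveragingDeficitPeriodicCounting (flux_add_period)
open NE3LatticeWeitzenbock (sum_sum_eq_two_mul_sum_plane)
open NE3CovariantCalculus
open NE3CovariantWeitzenbock (plaq_bound_of_smallField)
open NE7CovariantWeitzenbockTwoForm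
open NE7LatticeBianchi (covariant_bianchi_le)
open MinimalActionRate (sfClass)

noncomputable section

variable {d : ℕ} {n : Type*} [Fintype n] [DecidableEq n]

/-! ## §1 The antisymmetric flux 2-form, characterised -/

section FluxForm

variable {U : Site d → Fin d → (Matrix n n ℂ)ˣ} {B : Site d → Fin d → Fin d → Matrix n n ℂ}

/-- Such a `B` exists: extend the flux by antisymmetry and zero on the diagonal. [folklore] -/
theorem exists_fluxForm (U : Site d → Fin d → (Matrix n n ℂ)ˣ) :
    ∃ B : Site d → Fin d → Fin d → Matrix n n ℂ,
      (∀ (x : Site d) (μ ν : Fin d) (h : μ < ν), B x μ ν = flux U (x, ⟨(μ, ν), h⟩)) ∧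
      (∀ (x : Site d) (μ ν : Fin d), B x ν μ = -B x μ ν) := by
  classical
  refine ⟨fun x μ ν => if h : μ < ν then flux U (x, ⟨(μ, ν), h⟩) else if h' : ν < μ then -flux U (x, ⟨(ν, μ), h'⟩) else 0,
    fun x μ ν h => by simp [h], fun x μ ν => ?_⟩
  rcases lt_trichotomy μ ν with h | h | h
  · simp [h, lt_asymm h]
  · subst h; simp
  · simp [h, lt_asymm h]

omit [Fintype n] [DecidableEq n] in
/-- The diagonal of an antisymmetric 2-form vanishes. [folklore] -/
theorem fluxForm_diag (hanti : ∀ (x : Site d) (μ ν : Fin d), B x ν μ = -B x μ ν) (x : Site d) (μ : Fin d) : B x μ μ = 0 := by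
  have h := hanti x μ μ
  ext i j
  have hij : B x μ μ i j = -B x μ μ i j := by
    conv_lhs => rw [h]
    rfl
  have h2 : (2 : ℂ) * B x μ μ i j = 0 := by
    rw [two_mul]
    nth_rewrite 1 [hij]
    ring
  simpa using h2

/-- The flux form of a periodic configuration is periodic. [folklore] -/
theorem fluxForm_periodic {P : ℤ} (hUP : IsPeriodicCfg U P)
    (hBF : ∀ (x : Site d) (μ ν : Fin d) (h : μ < ν), B x μ ν = flux U (x, ⟨(μ, ν), h⟩))
    (hanti : ∀ (x : Site d) (μ ν : Fin d), B x ν μ = -B x μ ν) (x : Site d) (κ μ ν : Fin d) :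
    B (x + P • e κ) μ ν = B x μ ν := by
  rcases lt_trichotomy μ ν with h | h | h
  · rw [hBF _ μ ν h, hBF _ μ ν h, flux_add_period hUP]
  · subst h; rw [fluxForm_diag hanti, fluxForm_diag hanti]
  · rw [hanti _ ν μ, hanti _ ν μ, hBF _ ν μ h, hBF _ ν μ h, flux_add_period hUP]

/-- `‖B(x; μ, ν)‖ ≤ 2a` in `SmallField U a`, `0 ≤ a ≤ ½` (`‖log X‖ ≤ 2‖X − 1‖`, `MatrixLog.norm_mlog_le_two_mul`). [folklore] -/
theorem norm_fluxForm_le {a : ℝ} (ha0 : 0 ≤ a) (ha : a ≤ 1 / 2) (hUa : SmallField U a)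
    (hBF : ∀ (x : Site d) (μ ν : Fin d) (h : μ < ν), B x μ ν = flux U (x, ⟨(μ, ν), h⟩))
    (hanti : ∀ (x : Site d) (μ ν : Fin d), B x ν μ = -B x μ ν) (x : Site d) (μ ν : Fin d) :
    ‖B x μ ν‖ ≤ 2 * a := by
  have hlt : ∀ (μ ν : Fin d) (h : μ < ν), ‖B x μ ν‖ ≤ 2 * a := by
    intro μ ν h
    rw [hBF x μ ν h]
    have h1 : ‖((fhol U (x, ⟨(μ, ν), h⟩) : (Matrix n n ℂ)ˣ) : Matrix n n ℂ) - 1‖ ≤ a := hUa x μ ν (ne_of_lt h)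
    unfold flux
    exact (norm_mlog_le_two_mul (h1.trans ha)).trans (by linarith)
  rcases lt_trichotomy μ ν with h | h | h
  · exact hlt μ ν h
  · subst h; rw [fluxForm_diag hanti, norm_zero]; linarith
  · rw [hanti x ν μ, norm_neg]; exact hlt ν μ h

/-- On planes the covariant difference of the flux form is the tree's covariant flux gradient:
`∇_κ B_{μν}(x) = covGrad U (flux U) x κ (μ<ν)`. [folklore] -/
theorem cD_fluxForm (hBF : ∀ (x : Site d) (μ ν : Fin d) (h : μ < ν), B x μ ν = flux U (x, ⟨(μ, ν), h⟩))
    (x : Site d) (κ : Fin d) {μ ν : Fin d} (h : μ < ν) :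
    cD U κ (fun y => B y μ ν) x = covGrad U (flux U) x κ ⟨(μ, ν), h⟩ := by
  have hf : (fun y => B y μ ν) = fun y => flux U (y, ⟨(μ, ν), h⟩) := funext fun y => hBF y μ ν h
  rw [hf]
  rfl

/-- The covariant difference of the zero function vanishes. [folklore] -/
theorem cD_zero_fun (V : Site d → Fin d → (Matrix n n ℂ)ˣ) (κ : Fin d) (x : Site d) :
    cD V κ (fun _ => (0 : Matrix n n ℂ)) x = 0 := by
  unfold cD
  rw [Ad_zero, sub_zero]

/-- **THE GRADIENT ENERGY OF THE FLUX FORM IS TWICE THE PLANE-INDEXED ONE**: at every site and bond direction,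
`Σ_μ Σ_ν nhsNormSq (∇_κ B_{μν}) = 2·Σ_π nhsNormSq (covGrad U (flux U) x κ π)`. [folklore] -/
theorem grad_energy_eq (hBF : ∀ (x : Site d) (μ ν : Fin d) (h : μ < ν), B x μ ν = flux U (x, ⟨(μ, ν), h⟩))
    (hanti : ∀ (x : Site d) (μ ν : Fin d), B x ν μ = -B x μ ν) (x : Site d) (κ : Fin d) :
    ∑ μ : Fin d, ∑ ν : Fin d, nhsNormSq (cD U κ (fun y => B y μ ν) x)
      = 2 * ∑ π : T4AveragingDeficitWall.Plane d, nhsNormSq (covGrad U (flux U) x κ π) := by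
  have hdiag : ∀ μ : Fin d, nhsNormSq (cD U κ (fun y => B y μ μ) x) = 0 := by
    intro μ
    have hf : (fun y => B y μ μ) = fun _ => (0 : Matrix n n ℂ) := funext fun y => fluxForm_diag hanti y μ
    rw [hf, cD_zero_fun]
    simp [MatrixNorms.nhsNormSq]
  have hsymm : ∀ μ ν : Fin d, nhsNormSq (cD U κ (fun y => B y μ ν) x) = nhsNormSq (cD U κ (fun y => B y ν μ) x) := by
    intro μ ν
    have hf : (fun y => B y ν μ) = fun y => -B y μ ν := funext fun y => hanti y μ ν
    rw [hf, cD_neg, nhsNormSq_neg]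
  rw [sum_sum_eq_two_mul_sum_plane (fun μ ν => nhsNormSq (cD U κ (fun y => B y μ ν) x)) hdiag hsymm]
  congr 1
  exact Finset.sum_congr rfl fun π _ => by rw [cD_fluxForm hBF x κ π.2]

/-! ## §2 The Bianchi expression on all index triples -/

/-- Transposing the first two indices flips the sign of the cyclic sum `∇_κ B_{μν} + ∇_μ B_{νκ} + ∇_ν B_{κμ}`. [folklore] -/
theorem cyc_swap12 (hanti : ∀ (x : Site d) (μ ν : Fin d), B x ν μ = -B x μ ν) (x : Site d) (κ μ ν : Fin d) :
    cD U μ (fun y => B y κ ν) x + cD U κ (fun y => B y ν μ) x + cD U ν (fun y => B y μ κ) x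
      = -(cD U κ (fun y => B y μ ν) x + cD U μ (fun y => B y ν κ) x + cD U ν (fun y => B y κ μ) x) := by
  have h1 : (fun y => B y κ ν) = fun y => -B y ν κ := funext fun y => hanti y ν κ
  have h2 : (fun y => B y ν μ) = fun y => -B y μ ν := funext fun y => hanti y μ ν
  have h3 : (fun y => B y μ κ) = fun y => -B y κ μ := funext fun y => hanti y κ μ
  rw [h1, h2, h3, cD_neg, cD_neg, cD_neg]
  abel

/-- Transposing the last two indices flips the sign of the cyclic sum. [folklore] -/
theorem cyc_swap23 (hanti : ∀ (x : Site d) (μ ν : Fin d), B x ν μ = -B x μ ν) (x : Site d) (κ μ ν : Fin d) :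
    cD U κ (fun y => B y ν μ) x + cD U ν (fun y => B y μ κ) x + cD U μ (fun y => B y κ ν) x
      = -(cD U κ (fun y => B y μ ν) x + cD U μ (fun y => B y ν κ) x + cD U ν (fun y => B y κ μ) x) := by
  have h1 : (fun y => B y ν μ) = fun y => -B y μ ν := funext fun y => hanti y μ ν
  have h2 : (fun y => B y μ κ) = fun y => -B y κ μ := funext fun y => hanti y κ μ
  have h3 : (fun y => B y κ ν) = fun y => -B y ν κ := funext fun y => hanti y ν κ
  rw [h1, h2, h3, cD_neg, cD_neg, cD_neg]
  abel

/-- **THE LINEARISED BIANCHI IDENTITY ON EVERY INDEX TRIPLE**: for `U(N)`-valued `U` in `SmallField U a`, `a ≤ 1∕50`, and its flux form `B`,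
`‖∇_κ B_{μν}(x) + ∇_μ B_{νκ}(x) + ∇_ν B_{κμ}(x)‖ ≤ 248·a²` for ALL `κ, μ, ν` (sorted triples: `NE7LatticeBianchi.covariant_bianchi_le`; the other
orderings by total antisymmetry; degenerate triples vanish). [folklore] -/
theorem norm_cyc_le [Nonempty n] (hU : IsUnitaryCfg U) {a : ℝ} (ha : a ≤ 1 / 50) (hUa : SmallField U a)
    (hBF : ∀ (x : Site d) (μ ν : Fin d) (h : μ < ν), B x μ ν = flux U (x, ⟨(μ, ν), h⟩))
    (hanti : ∀ (x : Site d) (μ ν : Fin d), B x ν μ = -B x μ ν) (x : Site d) (κ μ ν : Fin d) :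
    ‖cD U κ (fun y => B y μ ν) x + cD U μ (fun y => B y ν κ) x + cD U ν (fun y => B y κ μ) x‖ ≤ 248 * a ^ 2 := by
  obtain ⟨E, hE⟩ : ∃ E : Fin d → Fin d → Fin d → Matrix n n ℂ, ∀ κ μ ν,
      E κ μ ν = cD U κ (fun y => B y μ ν) x + cD U μ (fun y => B y ν κ) x + cD U ν (fun y => B y κ μ) x := ⟨_, fun _ _ _ => rfl⟩
  rw [← hE]
  have s12 : ∀ κ μ ν : Fin d, ‖E μ κ ν‖ = ‖E κ μ ν‖ := fun κ μ ν => by rw [hE, hE κ μ ν, cyc_swap12 hanti, norm_neg]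
  have s23 : ∀ κ μ ν : Fin d, ‖E κ ν μ‖ = ‖E κ μ ν‖ := fun κ μ ν => by rw [hE, hE κ μ ν, cyc_swap23 hanti, norm_neg]
  have ha2 : 0 ≤ 248 * a ^ 2 := by positivity
  -- degenerate triples
  have hdeg12 : ∀ κ ν : Fin d, ‖E κ κ ν‖ ≤ 248 * a ^ 2 := by
    intro κ ν
    have h := cyc_swap12 hanti x κ κ ν (U := U)
    rw [← hE] at h
    have h0 : E κ κ ν = 0 := by
      have h2 : (2 : ℂ) • E κ κ ν = 0 := by rw [two_smul]; nth_rewrite 1 [h]; exact neg_add_cancel _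
      rcases smul_eq_zero.mp h2 with h3 | h3
      · norm_num at h3
      · exact h3
    rw [h0, norm_zero]; exact ha2
  have hdeg23 : ∀ κ μ : Fin d, ‖E κ μ μ‖ ≤ 248 * a ^ 2 := by
    intro κ μ
    have h := cyc_swap23 hanti x κ μ μ (U := U)
    rw [← hE] at h
    have h0 : E κ μ μ = 0 := by
      have h2 : (2 : ℂ) • E κ μ μ = 0 := by rw [two_smul]; nth_rewrite 1 [h]; exact neg_add_cancel _
      rcases smul_eq_zero.mp h2 with h3 | h3
      · norm_num at h3
      · exact h3
    rw [h0, norm_zero]; exact ha2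
  -- sorted triples: the tree's linearised Bianchi identity
  have hsort : ∀ κ μ ν : Fin d, κ < μ → μ < ν → ‖E κ μ ν‖ ≤ 248 * a ^ 2 := by
    intro κ μ ν hκμ hμν
    have hf : (fun y => B y ν κ) = fun y => -B y κ ν := funext fun y => hanti y κ ν
    rw [hE, hf, cD_neg, cD_fluxForm hBF x κ hμν, cD_fluxForm hBF x μ (hκμ.trans hμν), cD_fluxForm hBF x ν hκμ, ← sub_eq_add_neg]
    exact covariant_bianchi_le hU ha hUa x hκμ hμν
  -- the six orderings and the degenerate cases
  rcases lt_trichotomy κ μ with h1 | h1 | h1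
  · rcases lt_trichotomy μ ν with h2 | h2 | h2
    · exact hsort κ μ ν h1 h2
    · subst h2; exact hdeg23 κ μ
    · rcases lt_trichotomy κ ν with h3 | h3 | h3
      · rw [← s23]; exact hsort κ ν μ h3 h2
      · subst h3; rw [← s12]; exact hdeg23 μ κ
      · rw [← s23, ← s12]; exact hsort ν κ μ h3 h1
  · subst h1; exact hdeg12 κ ν
  · rcases lt_trichotomy κ ν with h2 | h2 | h2
    · rw [← s12]; exact hsort μ κ ν h1 h2
    · subst h2; rw [← s12]; exact hdeg23 μ κ
    · rcases lt_trichotomy μ ν with h3 | h3 | h3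
      · rw [← s12, ← s23]; exact hsort μ ν κ h3 h2
      · subst h3; exact hdeg23 κ μ
      · rw [← s12, ← s23, ← s12]; exact hsort ν μ κ h3 h1

/-- Hence the exterior-derivative energy of the flux form over a period box is FOURTH ORDER in `a`:
`C₂ ≤ P^d · d³ · (248a²)²`. [folklore] -/
theorem ext_energy_le [Nonempty n] (hU : IsUnitaryCfg U) {a : ℝ} (ha : a ≤ 1 / 50) (hUa : SmallField U a)
    (hBF : ∀ (x : Site d) (μ ν : Fin d) (h : μ < ν), B x μ ν = flux U (x, ⟨(μ, ν), h⟩))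
    (hanti : ∀ (x : Site d) (μ ν : Fin d), B x ν μ = -B x μ ν) (P : ℕ) :
    (∑ x ∈ periodBox (d := d) P, ∑ κ : Fin d, ∑ μ : Fin d, ∑ ν : Fin d,
        nhsNormSq (cD U κ (fun y => B y μ ν) x + cD U μ (fun y => B y ν κ) x + cD U ν (fun y => B y κ μ) x))
      ≤ (P : ℝ) ^ d * (d : ℝ) ^ 3 * (248 * a ^ 2) ^ 2 := by
  have hpt : ∀ (x : Site d) (κ μ ν : Fin d),
      nhsNormSq (cD U κ (fun y => B y μ ν) x + cD U μ (fun y => B y ν κ) x + cD U ν (fun y => B y κ μ) x) ≤ (248 * a ^ 2) ^ 2 :=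
    fun x κ μ ν => (nhsNormSq_le_opNorm_sq _).trans (pow_le_pow_left₀ (norm_nonneg _) (norm_cyc_le hU ha hUa hBF hanti x κ μ ν) 2)
  calc (∑ x ∈ periodBox (d := d) P, ∑ κ : Fin d, ∑ μ : Fin d, ∑ ν : Fin d,
        nhsNormSq (cD U κ (fun y => B y μ ν) x + cD U μ (fun y => B y ν κ) x + cD U ν (fun y => B y κ μ) x))
      ≤ ∑ x ∈ periodBox (d := d) P, ∑ κ : Fin d, ∑ μ : Fin d, ∑ ν : Fin d, (248 * a ^ 2) ^ 2 :=
        Finset.sum_le_sum fun x _ => Finset.sum_le_sum fun κ _ => Finset.sum_le_sum fun μ _ => Finset.sum_le_sum fun ν _ => hpt x κ μ ν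
    _ = (P : ℝ) ^ d * (d : ℝ) ^ 3 * (248 * a ^ 2) ^ 2 := by
        simp only [Finset.sum_const, Finset.card_univ, Fintype.card_fin, nsmul_eq_mul, card_periodBox]
        push_cast
        ring

/-- The `ℓ²` norm of the flux form over a period box: `Σ_x Σ_μ Σ_ν ‖B(x;μ,ν)‖² ≤ P^d·d²·(2a)²`. [folklore] -/
theorem normSq_fluxForm_le {a : ℝ} (ha0 : 0 ≤ a) (ha : a ≤ 1 / 2) (hUa : SmallField U a)
    (hBF : ∀ (x : Site d) (μ ν : Fin d) (h : μ < ν), B x μ ν = flux U (x, ⟨(μ, ν), h⟩))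
    (hanti : ∀ (x : Site d) (μ ν : Fin d), B x ν μ = -B x μ ν) (P : ℕ) :
    ∑ x ∈ periodBox (d := d) P, ∑ μ : Fin d, ∑ ν : Fin d, ‖B x μ ν‖ ^ 2 ≤ (P : ℝ) ^ d * (d : ℝ) ^ 2 * (2 * a) ^ 2 := by
  have hpt : ∀ (x : Site d) (μ ν : Fin d), ‖B x μ ν‖ ^ 2 ≤ (2 * a) ^ 2 :=
    fun x μ ν => pow_le_pow_left₀ (norm_nonneg _) (norm_fluxForm_le ha0 ha hUa hBF hanti x μ ν) 2
  calc ∑ x ∈ periodBox (d := d) P, ∑ μ : Fin d, ∑ ν : Fin d, ‖B x μ ν‖ ^ 2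
      ≤ ∑ x ∈ periodBox (d := d) P, ∑ μ : Fin d, ∑ ν : Fin d, (2 * a) ^ 2 :=
        Finset.sum_le_sum fun x _ => Finset.sum_le_sum fun μ _ => Finset.sum_le_sum fun ν _ => hpt x μ ν
    _ = (P : ℝ) ^ d * (d : ℝ) ^ 2 * (2 * a) ^ 2 := by
        simp only [Finset.sum_const, Finset.card_univ, Fintype.card_fin, nsmul_eq_mul, card_periodBox]
        push_cast
        ring

/-! ## §3 Step (E1): the flux-gradient energy against the tension energy -/

/-- **STEP (E1) OF THE ENERGY ROAD — THE FLUX-GRADIENT ENERGY IS THE TENSION ENERGY UP TO `O(a³)` PER SITE.**  For `P ≥ 1`, a `U(N)`-valued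
`P`-periodic `U` in `SmallField U a` with `0 ≤ a ≤ 1∕50`, and its antisymmetric flux form `B` (`B(x;μ,ν) = F(x;μ<ν)`, `B(x;ν,μ) = −B(x;μ,ν)`):

  `gradFluxSq U (periodBox P) ≤ card n · Σ_{x ∈ periodBox P} Σ_ν nhsNormSq (Σ_μ ∇_μ^† B_{μν}(x)) + 220·card n·d³·a³·P^d`

(`∇_μ^† = NE3CovariantCalculus.cDstar U μ`; `Σ_μ ∇_μ^† B_{μν}` is minus the covariant divergence of the flux = the lattice Yang–Mills tension).
Proof: `‖X‖² ≤ card n·nhsNormSq X`, `grad_energy_eq`, the 2-form Weitzenböck inequality `grad_le_ext_add_div`, the Bianchi bound `ext_energy_le`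
(`(248a²)²∕6 ≤ 206·a³` for `a ≤ 1∕50`) and `normSq_fluxForm_le` (`4·d·a·d²·4a² = 16 d³ a³ ≤ …`). [folklore] -/
theorem gradFluxSq_le_tension [Nonempty n] {P : ℕ} (hP : 1 ≤ P) (hU : IsUnitaryCfg U) (hUP : IsPeriodicCfg U (P : ℤ))
    {a : ℝ} (ha0 : 0 ≤ a) (ha : a ≤ 1 / 50) (hUa : SmallField U a)
    (hBF : ∀ (x : Site d) (μ ν : Fin d) (h : μ < ν), B x μ ν = flux U (x, ⟨(μ, ν), h⟩))
    (hanti : ∀ (x : Site d) (μ ν : Fin d), B x ν μ = -B x μ ν) :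
    gradFluxSq U (periodBox (d := d) P)
      ≤ (Fintype.card n : ℝ) * (∑ x ∈ periodBox (d := d) P, ∑ ν : Fin d, nhsNormSq (∑ μ : Fin d, cDstar U μ (fun y => B y μ ν) x))
        + 220 * (Fintype.card n : ℝ) * (d : ℝ) ^ 3 * a ^ 3 * (P : ℝ) ^ d := by
  have hcard : (0 : ℝ) ≤ (Fintype.card n : ℝ) := Nat.cast_nonneg _
  have ha2 : a ≤ 1 / 2 := ha.trans (by norm_num)
  -- operator norm against the HS currency, and the plane count
  have h1 : gradFluxSq U (periodBox (d := d) P)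
      ≤ (Fintype.card n : ℝ) / 2 * ∑ x ∈ periodBox (d := d) P, ∑ κ : Fin d, ∑ μ : Fin d, ∑ ν : Fin d, nhsNormSq (cD U κ (fun y => B y μ ν) x) := by
    unfold gradFluxSq
    rw [Finset.mul_sum]
    refine Finset.sum_le_sum fun x _ => ?_
    rw [Finset.mul_sum]
    refine Finset.sum_le_sum fun κ _ => ?_
    rw [grad_energy_eq hBF hanti x κ, Finset.mul_sum, Finset.mul_sum]
    refine Finset.sum_le_sum fun π _ => ?_
    have h := opNorm_sq_le_card_mul_nhsNormSq (covGrad U (flux U) x κ π)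
    linarith
  -- the 2-form Weitzenböck inequality at the flux form
  have hplaq := plaq_bound_of_smallField ha0 hUa
  have h2 := grad_le_ext_add_div hP hU hUP hplaq (fluxForm_periodic hUP hBF hanti) hanti
  -- the Bianchi and size bounds
  have h3 := ext_energy_le hU ha hUa hBF hanti P
  have h4 := normSq_fluxForm_le ha0 ha2 hUa hBF hanti P
  have hPd : (0 : ℝ) ≤ (P : ℝ) ^ d := by positivity
  have hd : (0 : ℝ) ≤ (d : ℝ) := Nat.cast_nonneg _
  -- the coefficient arithmetic: `(248a²)²/6 + 16·a³ ≤ 220·a³`... via `a ≤ 1/50`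
  have h5 : 4 * (d : ℝ) * a * (∑ x ∈ periodBox (d := d) P, ∑ μ : Fin d, ∑ ν : Fin d, ‖B x μ ν‖ ^ 2)
      ≤ 4 * (d : ℝ) * a * ((P : ℝ) ^ d * (d : ℝ) ^ 2 * (2 * a) ^ 2) :=
    mul_le_mul_of_nonneg_left h4 (by positivity)
  have h6 : (P : ℝ) ^ d * (d : ℝ) ^ 3 * (248 * a ^ 2) ^ 2 / 3 + 4 * (d : ℝ) * a * ((P : ℝ) ^ d * (d : ℝ) ^ 2 * (2 * a) ^ 2)
      ≤ 2 * (220 * (d : ℝ) ^ 3 * a ^ 3 * (P : ℝ) ^ d) := by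
    have ha4 : a ^ 4 ≤ a ^ 3 * (1 / 50) := by
      rw [pow_succ]; exact mul_le_mul_of_nonneg_left ha (by positivity)
    have hx : 0 ≤ (P : ℝ) ^ d * (d : ℝ) ^ 3 := by positivity
    nlinarith [mul_le_mul_of_nonneg_left ha4 hx]
  have hsum0 : 0 ≤ ∑ x ∈ periodBox (d := d) P, ∑ ν : Fin d, nhsNormSq (∑ μ : Fin d, cDstar U μ (fun y => B y μ ν) x) :=
    Finset.sum_nonneg fun x _ => Finset.sum_nonneg fun ν _ => nhsNormSq_nonneg _
  calc gradFluxSq U (periodBox (d := d) P)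
      ≤ (Fintype.card n : ℝ) / 2 * ∑ x ∈ periodBox (d := d) P, ∑ κ : Fin d, ∑ μ : Fin d, ∑ ν : Fin d,
          nhsNormSq (cD U κ (fun y => B y μ ν) x) := h1
    _ ≤ (Fintype.card n : ℝ) / 2 * ((P : ℝ) ^ d * (d : ℝ) ^ 3 * (248 * a ^ 2) ^ 2 / 3
          + 2 * (∑ x ∈ periodBox (d := d) P, ∑ ν : Fin d, nhsNormSq (∑ μ : Fin d, cDstar U μ (fun y => B y μ ν) x))
          + 4 * (d : ℝ) * a * ((P : ℝ) ^ d * (d : ℝ) ^ 2 * (2 * a) ^ 2)) := by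
        refine mul_le_mul_of_nonneg_left ?_ (by positivity)
        linarith [h2, h3, h5]
    _ ≤ (Fintype.card n : ℝ) * (∑ x ∈ periodBox (d := d) P, ∑ ν : Fin d, nhsNormSq (∑ μ : Fin d, cDstar U μ (fun y => B y μ ν) x))
          + 220 * (Fintype.card n : ℝ) * (d : ℝ) ^ 3 * a ^ 3 * (P : ℝ) ^ d := by
        nlinarith [mul_le_mul_of_nonneg_left h6 hcard]

/-- **STEP (E1) IN THE CURRENCY OF (H∃)ᴱ.**  For `U ∈ sfClass d L N ε k` (`L ≥ 1`, `0 ≤ ε`, `ε·(L^k)^{−2} ≤ 1∕50`) and its antisymmetric flux form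
`B`:  `gradFluxSq U (periodBox (N·L^k)) ≤ card n·Σ_x Σ_ν nhsNormSq (Σ_μ ∇_μ^† B_{μν}(x)) + 220·card n·d³·ε³ · N^d·(L^k)^d∕(L^k)⁶` —
the a-priori shape `g·N^d·(L^k)^d∕(L^k)⁶` of `NE7EtaBackgroundEnergyClass.hminE_of_apriori` with a LEVEL-FREE `g = 220·card n·d³·ε³` for the
remainder; (H∃)ᴱ is thereby REDUCED to the same decay for the tension energy of one constrained minimiser per level (steps (E2), (E3), (8) of the
hunt memo — NOT proved here). [folklore] -/
theorem gradFluxSq_le_tension_sfClass [Nonempty n] {L N k : ℕ} (hL : 1 ≤ L) (hN : 1 ≤ N) {ε : ℝ} (hε0 : 0 ≤ ε)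
    (hε : ε / ((L : ℝ) ^ k) ^ 2 ≤ 1 / 50) (hU : U ∈ sfClass d L N ε k)
    (hBF : ∀ (x : Site d) (μ ν : Fin d) (h : μ < ν), B x μ ν = flux U (x, ⟨(μ, ν), h⟩))
    (hanti : ∀ (x : Site d) (μ ν : Fin d), B x ν μ = -B x μ ν) :
    gradFluxSq U (periodBox (d := d) (N * L ^ k))
      ≤ (Fintype.card n : ℝ) * (∑ x ∈ periodBox (d := d) (N * L ^ k), ∑ ν : Fin d,
            nhsNormSq (∑ μ : Fin d, cDstar U μ (fun y => B y μ ν) x))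
        + 220 * (Fintype.card n : ℝ) * (d : ℝ) ^ 3 * ε ^ 3 * ((N : ℝ) ^ d * ((L : ℝ) ^ k) ^ d / ((L : ℝ) ^ k) ^ 6) := by
  have hLk : (0 : ℝ) < (L : ℝ) ^ k := pow_pos (by exact_mod_cast hL) k
  have hP : 1 ≤ N * L ^ k := Nat.one_le_iff_ne_zero.mpr (Nat.mul_ne_zero (by omega) (pow_ne_zero _ (by omega)))
  have ha0 : 0 ≤ ε / ((L : ℝ) ^ k) ^ 2 := by positivity
  have h := gradFluxSq_le_tension hP hU.1 hU.2.1 ha0 hε hU.2.2 hBF hanti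
  have hcast : ((N * L ^ k : ℕ) : ℝ) ^ d = (N : ℝ) ^ d * ((L : ℝ) ^ k) ^ d := by push_cast; ring
  rw [hcast] at h
  have hkey : (ε / ((L : ℝ) ^ k) ^ 2) ^ 3 * ((N : ℝ) ^ d * ((L : ℝ) ^ k) ^ d)
      = ε ^ 3 * ((N : ℝ) ^ d * ((L : ℝ) ^ k) ^ d / ((L : ℝ) ^ k) ^ 6) := by
    field_simp
  calc gradFluxSq U (periodBox (d := d) (N * L ^ k))
      ≤ (Fintype.card n : ℝ) * (∑ x ∈ periodBox (d := d) (N * L ^ k), ∑ ν : Fin d,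
            nhsNormSq (∑ μ : Fin d, cDstar U μ (fun y => B y μ ν) x))
        + 220 * (Fintype.card n : ℝ) * (d : ℝ) ^ 3 * (ε / ((L : ℝ) ^ k) ^ 2) ^ 3 * ((N : ℝ) ^ d * ((L : ℝ) ^ k) ^ d) := h
    _ = _ := by rw [mul_assoc (220 * (Fintype.card n : ℝ) * (d : ℝ) ^ 3), hkey, ← mul_assoc]

end FluxForm

end

end Summit.QuantumFields.BalabanUV.T4Continuum.NE7FluxGradientFromTension
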